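import Mathlib.Probability.Moments.Variance
import Literature.Probability.Percolation.SharpnessDCTProofs
import Summits.CriticalPhenomena.PercolationContinuityZ3.Theses.PercNonSelfAveraging

/-!
# Route `PercNonSelfAveraging`, item `LowerTailLadder` (stmt-CriticalPhenomena-7062)

`LowerTailLadder` says `ArmMassLowerTail → ArmMassNSA`: if, for some `c > 0` and infinitely many `n`,
the critical arm mass `M_n = ∑_{x ∈ B(n)} 1{x ↔ ∂^{in}B(2n) inside B(2n)}` of bond percolation on `ℤ³`
at `p_c` satisfies `P(M_n ≤ E M_n / 2) ≥ c`, then along the same `n` one has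
`Var(M_n) ≥ (c/4) (E M_n)²`.

Proof (Chebyshev, Grimmett 1999 §7.4 style second-moment bookkeeping): `M_n` is a finite sum of
indicators of measurable events (`DCT16.measurableSet_openConnIn`), hence bounded, measurable and in
`L²`; its mean `E ≥ 0`.  If `E = 0` the claim is `0 ≤ Var`.  Otherwise `{M_n ≤ E/2} ⊆ {E/2 ≤ |M_n − E|}`
and Chebyshev's inequality (`ProbabilityTheory.meas_ge_le_variance_div_sq`) gives
`c ≤ P(M_n ≤ E/2) ≤ Var(M_n) / (E/2)²`, i.e. `(c/4) E² ≤ Var(M_n)`.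

The two general-purpose steps (a lower-tail bound forces variance; a finite sum of indicators of
measurable sets is in `L²`) are proved for an arbitrary finite measure space first.
-/

namespace Summit.CriticalPhenomena.PercolationContinuityZ3.Theorems

open MeasureTheory ProbabilityTheory Filter
open Literature.Probability.LatticeModels Literature.Probability.Percolation

/-- **Lower tail forces variance** (Chebyshev read backwards). For a square-integrable real random
variable `X` with mean `μ[X] ≥ 0` under a finite measure: if `c ≤ μ{X ≤ μ[X]/2}` then
`(c/4) · μ[X]² ≤ Var[X]`.  Indeed `{X ≤ μ[X]/2} ⊆ {μ[X]/2 ≤ |X − μ[X]|}`, whose measure is at most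
`Var[X] / (μ[X]/2)²` by Chebyshev (`meas_ge_le_variance_div_sq`); the case `μ[X] = 0` is trivial.
[folklore] -/
theorem div_four_mul_sq_integral_le_variance_of_lowerTail {Ω : Type*} [MeasurableSpace Ω]
    {μ : Measure Ω} [IsFiniteMeasure μ] {X : Ω → ℝ} (hX : MemLp X 2 μ) (hE : 0 ≤ μ[X]) {c : ℝ}
    (hc : c ≤ μ.real {ω | X ω ≤ μ[X] / 2}) :
    c / 4 * (μ[X]) ^ 2 ≤ Var[X; μ] := by
  rcases hE.lt_or_eq with hpos | hzero
  · -- `E > 0`: Chebyshev at level `E / 2`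
    have hhalf : 0 < μ[X] / 2 := by positivity
    have hsub : {ω | X ω ≤ μ[X] / 2} ⊆ {ω | μ[X] / 2 ≤ |X ω - μ[X]|} := by
      intro ω hω
      simp only [Set.mem_setOf_eq] at hω ⊢
      rw [abs_sub_comm]
      exact le_trans (by linarith) (le_abs_self _)
    have hcheb := meas_ge_le_variance_div_sq hX hhalf
    have hreal : μ.real {ω | μ[X] / 2 ≤ |X ω - μ[X]|} ≤ Var[X; μ] / (μ[X] / 2) ^ 2 :=
      ENNReal.toReal_le_of_le_ofReal (div_nonneg (variance_nonneg X μ) (sq_nonneg _)) hcheb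
    have hmono : μ.real {ω | X ω ≤ μ[X] / 2} ≤ μ.real {ω | μ[X] / 2 ≤ |X ω - μ[X]|} :=
      measureReal_mono hsub
    have hc' : c ≤ Var[X; μ] / (μ[X] / 2) ^ 2 := hc.trans (hmono.trans hreal)
    have hsq : 0 < (μ[X] / 2) ^ 2 := by positivity
    have := (le_div_iff₀ hsq).mp hc'
    -- `c * (E/2)^2 ≤ Var`, and `c/4 * E^2 = c * (E/2)^2`
    calc c / 4 * (μ[X]) ^ 2 = c * (μ[X] / 2) ^ 2 := by ring
      _ ≤ Var[X; μ] := this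
  · -- `E = 0`
    rw [← hzero]
    simp

/-- A finite sum of indicators (value `1`) of measurable sets is measurable. [folklore] -/
theorem measurable_sum_indicator_one {Ω ι : Type*} [MeasurableSpace Ω] (s : Finset ι)
    (A : ι → Set Ω) (hA : ∀ i ∈ s, MeasurableSet (A i)) :
    Measurable (fun ω => ∑ i ∈ s, (A i).indicator (fun _ => (1 : ℝ)) ω) :=
  Finset.measurable_sum s fun i hi => measurable_const.indicator (hA i hi)

/-- A finite sum of indicators (value `1`) takes values in `[0, #s]`. [folklore] -/
theorem norm_sum_indicator_one_le {Ω ι : Type*} (s : Finset ι) (A : ι → Set Ω) (ω : Ω) :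
    ‖∑ i ∈ s, (A i).indicator (fun _ => (1 : ℝ)) ω‖ ≤ (s.card : ℝ) := by
  have h0 : ∀ i ∈ s, 0 ≤ (A i).indicator (fun _ => (1 : ℝ)) ω := fun _ _ =>
    Set.indicator_nonneg (fun _ _ => zero_le_one) ω
  have h1 : ∀ i ∈ s, (A i).indicator (fun _ => (1 : ℝ)) ω ≤ 1 := fun _ _ =>
    Set.indicator_le_self' (fun _ _ => zero_le_one) ω
  rw [Real.norm_of_nonneg (Finset.sum_nonneg h0)]
  calc ∑ i ∈ s, (A i).indicator (fun _ => (1 : ℝ)) ω ≤ ∑ _i ∈ s, (1 : ℝ) := Finset.sum_le_sum h1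
    _ = (s.card : ℝ) := by simp

/-- A finite sum of indicators (value `1`) of measurable sets is in `L²` of any finite measure
(bounded and measurable, `MemLp.of_bound`). [folklore] -/
theorem memLp_two_sum_indicator_one {Ω ι : Type*} [MeasurableSpace Ω] (μ : Measure Ω)
    [IsFiniteMeasure μ] (s : Finset ι) (A : ι → Set Ω) (hA : ∀ i ∈ s, MeasurableSet (A i)) :
    MemLp (fun ω => ∑ i ∈ s, (A i).indicator (fun _ => (1 : ℝ)) ω) 2 μ :=
  MemLp.of_bound (measurable_sum_indicator_one s A hA).aestronglyMeasurable (s.card : ℝ)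
    (Eventually.of_forall (norm_sum_indicator_one_le s A))

/-- The mean of a finite sum of indicators (value `1`) is nonnegative. [folklore] -/
theorem integral_sum_indicator_one_nonneg {Ω ι : Type*} [MeasurableSpace Ω] (μ : Measure Ω)
    (s : Finset ι) (A : ι → Set Ω) :
    0 ≤ ∫ ω, ∑ i ∈ s, (A i).indicator (fun _ => (1 : ℝ)) ω ∂μ :=
  integral_nonneg fun ω => Finset.sum_nonneg fun _ _ =>
    Set.indicator_nonneg (fun _ _ => zero_le_one) ω

/-- The arm event `{x ↔ T inside S} = ⋃_{y ∈ T} {x ↔ y in S}` of a finite vertex set `S` towards a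
finite target set `T` is measurable (finite union of the finitely determined events
`DCT16.measurableSet_openConnIn`). [folklore] -/
theorem measurableSet_exists_openConnIn {V : Type*} (S T : Finset V) (x : V) :
    MeasurableSet {ω : BondConfig V | ∃ y ∈ T, ω ∈ openConnIn (↑S : Set V) x y} := by
  have h : {ω : BondConfig V | ∃ y ∈ T, ω ∈ openConnIn (↑S : Set V) x y} =
      ⋃ y ∈ T, openConnIn (↑S : Set V) x y := by
    ext ω; simp
  rw [h]
  exact MeasurableSet.biUnion T.countable_toSet fun y _ => DCT16.measurableSet_openConnIn S x y

/-- **Item `stmt-CriticalPhenomena-7062` (`PercNonSelfAveraging.LowerTailLadder`), proved:**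
`ArmMassLowerTail → ArmMassNSA` with constant `c/4` along the same infinitely many `n`.
At each `n` with `P_{p_c}(M_n ≤ E M_n / 2) ≥ c`, the arm mass `M_n` (a finite sum of indicators of the
measurable arm events `{x ↔ ∂^{in}B(2n) in B(2n)}`) is in `L²` with `E M_n ≥ 0`, so the Chebyshev
ladder `div_four_mul_sq_integral_le_variance_of_lowerTail` gives `(c/4)(E M_n)² ≤ Var(M_n)`.
[folklore] -/
theorem lowerTailLadder_proof :
    Summit.CriticalPhenomena.PercolationContinuityZ3.Theses.PercNonSelfAveraging.LowerTailLadder := by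
  unfold Summit.CriticalPhenomena.PercolationContinuityZ3.Theses.PercNonSelfAveraging.LowerTailLadder
    Summit.CriticalPhenomena.PercolationContinuityZ3.Theses.PercNonSelfAveraging.ArmMassLowerTail
    Summit.CriticalPhenomena.PercolationContinuityZ3.Theses.PercNonSelfAveraging.ArmMassNSA
  rintro ⟨c, hc, hfreq⟩
  refine ⟨c / 4, by positivity, hfreq.mono fun n hn => ?_⟩
  have hA : ∀ x ∈ box 3 n, MeasurableSet {ω' : BondConfig (Site 3) |
      ∃ y ∈ innerBoundary (zdGraph 3) (box 3 (2 * n)),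
        ω' ∈ openConnIn (↑(box 3 (2 * n)) : Set (Site 3)) x y} :=
    fun x _ => measurableSet_exists_openConnIn (box 3 (2 * n)) _ x
  exact div_four_mul_sq_integral_le_variance_of_lowerTail
    (memLp_two_sum_indicator_one _ (box 3 n) _ hA)
    (integral_sum_indicator_one_nonneg _ (box 3 n) _) hn

end Summit.CriticalPhenomena.PercolationContinuityZ3.Theorems
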